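import Literature.NumberTheory.CubicFields.DavenportBoundNegPairs
import HarnessLib

/-!
# Davenport's bound, negative discriminant: summation

`Proofs` file (theorems only), topic `Literature/NumberTheory/CubicFields`, continuing
`DavenportBoundNegPairs.lean`.  With `X = ξ¹²` and `a = α³` the `(d, c)`-counts of
`DavenportBoundNegPairs` are summed over `0 ≤ b < (5/2)ξ³` and then over `1 ≤ a < ξ³`:

* generic sums: Bernoulli `x^{k+1} + (k+1)x^k ≤ (x+1)^{k+1}`, the tails `Σ_{j>n} j^{−(k+1)} ≤ 1/(k nᵏ)`
  (`sum_Ico_inv_pow_succ_le`), and `Σ_{n ≤ N} n^{−1/3} ≤ (3/2)N^{2/3}` (`sum_inv_cubeRoot_le`);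
* `sum_sq_mul_mu_le`, `sum_mu_le`, `sum_mu_sq_le` — the sums of `μ_b = min(ξ⁴/α⁴, 64X/b⁴)` split at
  `b₀ = ⌊2ξ²α⌋`;
* `ncard_aFibre_neg_le` — for fixed `a`: `#{(b, d, c)} ≤ 612ξ⁹ + 28a²ξ³ + 1600aξ⁶ + 77312ξ¹⁰/α`;
* `ncard_negRed_le` — **the number of Mathews-reduced `(a, b, c, d)` with `a ≥ 1`, `b ≥ 0`, `d ≠ 0`,
  `−Disc < X` is `≤ 118208·X`**.

## References

* H. Davenport, *On the class-number of binary cubic forms II*, J. London Math. Soc. 26 (1951)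
  192–198 [Davenport1951CubicFormsII].
-/

noncomputable section

namespace Literature.NumberTheory.CubicFields

namespace BinaryCubic

open Finset


/-! ### Generic sums -/

/-- **Bernoulli**: `x^{k+1} + (k+1)x^k ≤ (x+1)^{k+1}` for `x ≥ 0`. [folklore] -/
theorem pow_add_mul_pow_le (k : ℕ) {x : ℝ} (hx : 0 ≤ x) :
    x ^ (k + 1) + (k + 1) * x ^ k ≤ (x + 1) ^ (k + 1) := by
  induction k with
  | zero => simp
  | succ k ih =>
    have h1 : (x + 1) ^ (k + 2) = (x + 1) ^ (k + 1) * (x + 1) := by ring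
    rw [h1]
    have h2 : (x ^ (k + 1) + (k + 1) * x ^ k) * (x + 1) ≤ (x + 1) ^ (k + 1) * (x + 1) :=
      mul_le_mul_of_nonneg_right ih (by linarith)
    have e : (x ^ (k + 1) + (k + 1) * x ^ k) * (x + 1) =
        x ^ (k + 1 + 1) + ((k + 1 : ℕ) + 1) * x ^ (k + 1) + (k + 1) * x ^ k := by
      push_cast; ring
    have h3 : x ^ (k + 1 + 1) + ((k + 1 : ℕ) + 1) * x ^ (k + 1) ≤ (x ^ (k + 1) + (k + 1) * x ^ k) * (x + 1) := by
      rw [e]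
      have : 0 ≤ (k + 1 : ℝ) * x ^ k := by positivity
      linarith
    exact h3.trans h2

/-- The telescoping step `1/b^{k+1} ≤ (1/k)(1/(b−1)^k − 1/b^k)` for `b ≥ 2`... stated for `b = x + 1`,
`x ≥ 1`. [folklore] -/
theorem inv_pow_succ_le_sub {k : ℕ} (hk : 1 ≤ k) {x : ℝ} (hx : 1 ≤ x) :
    ((x + 1) ^ (k + 1))⁻¹ ≤ (k : ℝ)⁻¹ * ((x ^ k)⁻¹ - ((x + 1) ^ k)⁻¹) := by
  have hx0 : 0 < x := by linarith
  have hk0 : (0 : ℝ) < k := by exact_mod_cast hk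
  have hB := pow_add_mul_pow_le k hx0.le
  rw [show (k : ℝ)⁻¹ * ((x ^ k)⁻¹ - ((x + 1) ^ k)⁻¹) = ((x + 1) ^ k - x ^ k) / (k * (x ^ k * (x + 1) ^ k)) by
    field_simp]
  rw [inv_eq_one_div, div_le_div_iff₀ (by positivity) (by positivity)]
  -- `k x^k (x+1)^k ≤ ((x+1)^k − x^k)(x+1)^{k+1}`, i.e. `(k + x + 1) x^k ≤ (x+1)^{k+1}` times `(x+1)^k`
  have key : (k + (x + 1)) * x ^ k ≤ (x + 1) ^ (k + 1) := by
    have e : (k + (x + 1)) * x ^ k = x ^ (k + 1) + (k + 1) * x ^ k := by ring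
    rw [e]; exact hB
  have h1 : ((x + 1) ^ k - x ^ k) * (x + 1) ^ (k + 1) - 1 * (k * (x ^ k * (x + 1) ^ k)) =
      (x + 1) ^ k * ((x + 1) ^ (k + 1) - (k + (x + 1)) * x ^ k) := by ring
  nlinarith [h1, mul_nonneg (pow_nonneg (by linarith : (0 : ℝ) ≤ x + 1) k) (sub_nonneg.mpr key)]

/-- **Tail of `Σ b^{−(k+1)}`**: `Σ_{i<M} (n + 1 + i)^{−(k+1)} ≤ 1/(k n^k)` for `n ≥ 1`, `k ≥ 1`. [folklore] -/
theorem sum_inv_pow_succ_tail_le {k : ℕ} (hk : 1 ≤ k) {n : ℕ} (hn : 1 ≤ n) (M : ℕ) :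
    ∑ i ∈ Finset.range M, (((n + 1 + i : ℕ) : ℝ) ^ (k + 1))⁻¹ ≤ ((k : ℝ) * (n : ℝ) ^ k)⁻¹ := by
  have hk0 : (0 : ℝ) < k := by exact_mod_cast hk
  have hn0 : (0 : ℝ) < n := by exact_mod_cast hn
  have htail : ∀ M : ℕ, ∑ i ∈ Finset.range M, (((n + 1 + i : ℕ) : ℝ) ^ (k + 1))⁻¹ ≤
      (k : ℝ)⁻¹ * (((n : ℝ) ^ k)⁻¹ - (((n + M : ℕ) : ℝ) ^ k)⁻¹) := by
    intro M
    induction M with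
    | zero => simp
    | succ M ih =>
      rw [Finset.sum_range_succ]
      have hstep := inv_pow_succ_le_sub hk (x := ((n + M : ℕ) : ℝ)) (by
        push_cast
        have h1 : (1 : ℝ) ≤ n := by exact_mod_cast hn
        have h2 : (0 : ℝ) ≤ M := by positivity
        linarith)
      have e1 : ((n + 1 + M : ℕ) : ℝ) = ((n + M : ℕ) : ℝ) + 1 := by push_cast; ring
      have e2 : ((n + (M + 1) : ℕ) : ℝ) = ((n + M : ℕ) : ℝ) + 1 := by push_cast; ring
      rw [e1, e2]
      nlinarith [hstep, ih]
  refine (htail M).trans ?_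
  rw [mul_inv, mul_sub]
  have : 0 ≤ (k : ℝ)⁻¹ * (((n + M : ℕ) : ℝ) ^ k)⁻¹ := by positivity
  linarith

/-- `(u − v)²(u + 2v) ≥ 0`, i.e. `u³ − 3uv² + 2v³ ≥ 0`. [folklore] -/
theorem key_cubic_ineq {u v : ℝ} (hu : 0 ≤ u) (hv : 0 ≤ v) : 0 ≤ u ^ 3 - 3 * u * v ^ 2 + 2 * v ^ 3 := by
  have : u ^ 3 - 3 * u * v ^ 2 + 2 * v ^ 3 = (u - v) ^ 2 * (u + 2 * v) := by ring
  rw [this]; positivity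

/-- **`Σ_{n=1}^{N} n^{-1/3} ≤ (3/2) N^{2/3}`**, written with cube roots `α(n)³ = n`:
`Σ_{n<N} α(n+1)⁻¹ ≤ (3/2) α(N)²`. [folklore] -/
theorem sum_inv_cubeRoot_le (N : ℕ) :
    ∑ n ∈ Finset.range N, (((n + 1 : ℕ) : ℝ) ^ ((3 : ℕ) : ℝ)⁻¹)⁻¹ ≤
      3 / 2 * (((N : ℕ) : ℝ) ^ ((3 : ℕ) : ℝ)⁻¹) ^ 2 := by
  induction N with
  | zero => simp
  | succ N ih =>
    rw [Finset.sum_range_succ]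
    set u : ℝ := (((N + 1 : ℕ) : ℝ) ^ ((3 : ℕ) : ℝ)⁻¹) with hu
    set v : ℝ := (((N : ℕ) : ℝ) ^ ((3 : ℕ) : ℝ)⁻¹) with hv
    have hu3 : u ^ 3 = (N + 1 : ℕ) := Real.rpow_inv_natCast_pow (by positivity) (by norm_num)
    have hv3 : v ^ 3 = (N : ℕ) := Real.rpow_inv_natCast_pow (by positivity) (by norm_num)
    have hu0 : 0 < u := Real.rpow_pos_of_pos (by positivity) _
    have hv0 : 0 ≤ v := Real.rpow_nonneg (by positivity) _
    have huv : u ^ 3 - v ^ 3 = 1 := by rw [hu3, hv3]; push_cast; ring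
    have hvu : v ≤ u := by
      have : v ^ 3 ≤ u ^ 3 := by linarith
      exact le_of_pow_le_pow_left₀ (by norm_num) hu0.le this
    -- `1/u ≤ (3/2)(u² − v²)`
    have hkey : u⁻¹ ≤ 3 / 2 * (u ^ 2 - v ^ 2) := by
      rw [inv_eq_one_div, div_le_iff₀ hu0]
      nlinarith [key_cubic_ineq hu0.le hv0]
    linarith

/-- Splitting a sum over `range (N+1)` at `n₀`: for `f ≥ 0`,
`Σ_{j ≤ N} f j ≤ Σ_{j ≤ n₀} f j + Σ_{n₀ < j ≤ N} f j`. [folklore] -/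
theorem sum_range_le_split {f : ℕ → ℝ} (hf : ∀ j, 0 ≤ f j) (N n₀ : ℕ) :
    ∑ j ∈ Finset.range (N + 1), f j ≤
      ∑ j ∈ Finset.range (n₀ + 1), f j + ∑ j ∈ Finset.Ico (n₀ + 1) (N + 1), f j := by
  have hdisj : Disjoint (Finset.range (n₀ + 1)) (Finset.Ico (n₀ + 1) (N + 1)) := by
    rw [Finset.disjoint_left]
    intro j hj hj'
    rw [Finset.mem_range] at hj
    rw [Finset.mem_Ico] at hj'
    omega
  rw [← Finset.sum_union hdisj]
  apply Finset.sum_le_sum_of_subset_of_nonneg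
  · intro j hj
    rw [Finset.mem_union, Finset.mem_range, Finset.mem_Ico]
    rw [Finset.mem_range] at hj
    omega
  · intro j _ _; exact hf j

/-- Tail sums over `Ico (n₀+1) (N+1)` via `sum_inv_pow_succ_tail_le`. [folklore] -/
theorem sum_Ico_inv_pow_succ_le {k : ℕ} (hk : 1 ≤ k) {n₀ : ℕ} (hn₀ : 1 ≤ n₀) (N : ℕ) :
    ∑ j ∈ Finset.Ico (n₀ + 1) (N + 1), (((j : ℕ) : ℝ) ^ (k + 1))⁻¹ ≤ ((k : ℝ) * (n₀ : ℝ) ^ k)⁻¹ := by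
  rcases le_or_gt (n₀ + 1) (N + 1) with h | h
  · have : Finset.Ico (n₀ + 1) (N + 1) = (Finset.range (N + 1 - (n₀ + 1))).image (fun i => n₀ + 1 + i) := by
      ext j
      simp only [Finset.mem_Ico, Finset.mem_image, Finset.mem_range]
      constructor
      · intro hj; exact ⟨j - (n₀ + 1), by omega, by omega⟩
      · rintro ⟨i, hi, rfl⟩; omega
    rw [this, Finset.sum_image (fun i _ j _ hij => by omega)]
    exact sum_inv_pow_succ_tail_le hk hn₀ _
  · rw [Finset.Ico_eq_empty (by omega), Finset.sum_empty]
    positivity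


/-! ### The threshold `n₀ = ⌊2ξ²α⌋` -/

/-- Facts about `n₀ = ⌊2ξ²α⌋₊` for `ξ, α ≥ 1`: `1 ≤ n₀`, `ξ²α ≤ n₀ ≤ 2ξ²α`. [folklore] -/
theorem n0_facts {ξ α : ℝ} (hξ : 1 ≤ ξ) (hα : 1 ≤ α) :
    1 ≤ ⌊2 * ξ ^ 2 * α⌋₊ ∧ ξ ^ 2 * α ≤ (⌊2 * ξ ^ 2 * α⌋₊ : ℝ) ∧ (⌊2 * ξ ^ 2 * α⌋₊ : ℝ) ≤ 2 * ξ ^ 2 * α := by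
  have h1 : 1 ≤ ξ ^ 2 * α := by nlinarith
  have hfl := Nat.floor_le (by positivity : (0 : ℝ) ≤ 2 * ξ ^ 2 * α)
  have hlt := Nat.lt_floor_add_one (2 * ξ ^ 2 * α)
  refine ⟨?_, by linarith, hfl⟩
  have : (1 : ℝ) ≤ ⌊2 * ξ ^ 2 * α⌋₊ := by linarith
  exact_mod_cast this

/-- **`Σ_{j ≤ N} j² μ_j ≤ 80 ξ¹⁰/α`**, `μ_j = min(ξ⁴/α⁴, 64ξ¹²/j⁴)` (split at `n₀ = ⌊2ξ²α⌋`: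
head `≤ 2n₀³ ξ⁴/α⁴ ≤ 16ξ¹⁰/α`, tail `64ξ¹² Σ_{j>n₀} j⁻² ≤ 64ξ¹²/n₀ ≤ 64ξ¹⁰/α`). [folklore] -/
theorem sum_sq_mul_mu_le {ξ α : ℝ} (hξ : 1 ≤ ξ) (hα : 1 ≤ α) (N : ℕ) :
    ∑ j ∈ Finset.range (N + 1), ((j : ℕ) : ℝ) ^ 2 * min (ξ ^ 4 / α ^ 4) (64 * ξ ^ 12 / ((j : ℕ) : ℝ) ^ 4) ≤
      80 * ξ ^ 10 / α := by
  obtain ⟨hn1, hnlo, hnhi⟩ := n0_facts hξ hα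
  set n₀ : ℕ := ⌊2 * ξ ^ 2 * α⌋₊ with hn₀
  have hξ0 : 0 < ξ := by linarith
  have hα0 : 0 < α := by linarith
  have hn0R : (1 : ℝ) ≤ n₀ := by exact_mod_cast hn1
  set f : ℕ → ℝ := fun j => ((j : ℕ) : ℝ) ^ 2 * min (ξ ^ 4 / α ^ 4) (64 * ξ ^ 12 / ((j : ℕ) : ℝ) ^ 4)
    with hf
  have hf0 : ∀ j, 0 ≤ f j := fun j => mul_nonneg (sq_nonneg _) (le_min (by positivity) (by positivity))
  refine (sum_range_le_split hf0 N n₀).trans ?_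
  -- head
  have hhead : ∑ j ∈ Finset.range (n₀ + 1), f j ≤ (n₀ + 1) * ((n₀ : ℝ) ^ 2 * (ξ ^ 4 / α ^ 4)) := by
    have : ∀ j ∈ Finset.range (n₀ + 1), f j ≤ (n₀ : ℝ) ^ 2 * (ξ ^ 4 / α ^ 4) := by
      intro j hj
      rw [Finset.mem_range] at hj
      have hjn : ((j : ℕ) : ℝ) ≤ n₀ := by exact_mod_cast Nat.lt_succ_iff.mp hj
      calc f j ≤ ((j : ℕ) : ℝ) ^ 2 * (ξ ^ 4 / α ^ 4) :=
            mul_le_mul_of_nonneg_left (min_le_left _ _) (sq_nonneg _)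
        _ ≤ (n₀ : ℝ) ^ 2 * (ξ ^ 4 / α ^ 4) := by
            apply mul_le_mul_of_nonneg_right _ (by positivity)
            exact pow_le_pow_left₀ (by positivity) hjn 2
    refine (Finset.sum_le_sum this).trans ?_
    rw [Finset.sum_const, Finset.card_range, nsmul_eq_mul]; push_cast; rfl
  -- tail
  have htail : ∑ j ∈ Finset.Ico (n₀ + 1) (N + 1), f j ≤ 64 * ξ ^ 12 * (n₀ : ℝ)⁻¹ := by
    have h1 : ∀ j ∈ Finset.Ico (n₀ + 1) (N + 1), f j ≤ 64 * ξ ^ 12 * ((((j : ℕ) : ℝ)) ^ (1 + 1))⁻¹ := by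
      intro j hj
      rw [Finset.mem_Ico] at hj
      have hj0 : (0 : ℝ) < j := by exact_mod_cast (by omega : 0 < j)
      calc f j ≤ ((j : ℕ) : ℝ) ^ 2 * (64 * ξ ^ 12 / ((j : ℕ) : ℝ) ^ 4) :=
            mul_le_mul_of_nonneg_left (min_le_right _ _) (sq_nonneg _)
        _ = 64 * ξ ^ 12 * ((((j : ℕ) : ℝ)) ^ (1 + 1))⁻¹ := by field_simp
    refine (Finset.sum_le_sum h1).trans ?_
    rw [← Finset.mul_sum]
    have h2 := sum_Ico_inv_pow_succ_le (k := 1) le_rfl hn1 N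
    have h3 : ((1 : ℕ) * (n₀ : ℝ) ^ 1 : ℝ)⁻¹ = (n₀ : ℝ)⁻¹ := by simp
    rw [h3] at h2
    exact mul_le_mul_of_nonneg_left h2 (by positivity)
  -- numerics
  have e1 : (n₀ + 1) * ((n₀ : ℝ) ^ 2 * (ξ ^ 4 / α ^ 4)) ≤ 16 * ξ ^ 10 / α := by
    have h2 : (n₀ : ℝ) + 1 ≤ 2 * n₀ := by linarith
    have h3 : (n₀ + 1) * (n₀ : ℝ) ^ 2 ≤ 2 * (2 * ξ ^ 2 * α) ^ 3 := by
      have := pow_le_pow_left₀ (by positivity) hnhi 3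
      nlinarith [sq_nonneg (n₀ : ℝ)]
    rw [div_eq_mul_inv, le_div_iff₀ hα0]
    have hα4 : 0 < α ^ 4 := by positivity
    calc (n₀ + 1) * ((n₀ : ℝ) ^ 2 * (ξ ^ 4 * (α ^ 4)⁻¹)) * α
        = ((n₀ + 1) * (n₀ : ℝ) ^ 2) * (ξ ^ 4 * α * (α ^ 4)⁻¹) := by ring
      _ ≤ (2 * (2 * ξ ^ 2 * α) ^ 3) * (ξ ^ 4 * α * (α ^ 4)⁻¹) :=
          mul_le_mul_of_nonneg_right h3 (by positivity)
      _ = 16 * ξ ^ 10 := by field_simp; ring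
  have e2 : 64 * ξ ^ 12 * (n₀ : ℝ)⁻¹ ≤ 64 * ξ ^ 10 / α := by
    rw [div_eq_mul_inv]
    have : (n₀ : ℝ)⁻¹ ≤ (ξ ^ 2 * α)⁻¹ := by
      rw [inv_le_inv₀ (by positivity) (by positivity)]; exact hnlo
    calc 64 * ξ ^ 12 * (n₀ : ℝ)⁻¹ ≤ 64 * ξ ^ 12 * (ξ ^ 2 * α)⁻¹ :=
          mul_le_mul_of_nonneg_left this (by positivity)
      _ = 64 * ξ ^ 10 * α⁻¹ := by field_simp
  have : 16 * ξ ^ 10 / α + 64 * ξ ^ 10 / α = 80 * ξ ^ 10 / α := by ring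
  linarith

/-- **`Σ_{j ≤ N} μ_j ≤ 25 ξ⁶/α³`** (head `≤ (n₀+1) ξ⁴/α⁴ ≤ 3ξ⁶/α³`, tail
`64ξ¹² Σ_{j>n₀} j⁻⁴ ≤ 64ξ¹²/(3n₀³) ≤ 22ξ⁶/α³`). [folklore] -/
theorem sum_mu_le {ξ α : ℝ} (hξ : 1 ≤ ξ) (hα : 1 ≤ α) (N : ℕ) :
    ∑ j ∈ Finset.range (N + 1), min (ξ ^ 4 / α ^ 4) (64 * ξ ^ 12 / ((j : ℕ) : ℝ) ^ 4) ≤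
      25 * ξ ^ 6 / α ^ 3 := by
  obtain ⟨hn1, hnlo, hnhi⟩ := n0_facts hξ hα
  set n₀ : ℕ := ⌊2 * ξ ^ 2 * α⌋₊ with hn₀
  have hξ0 : 0 < ξ := by linarith
  have hα0 : 0 < α := by linarith
  have hn0R : (1 : ℝ) ≤ n₀ := by exact_mod_cast hn1
  set f : ℕ → ℝ := fun j => min (ξ ^ 4 / α ^ 4) (64 * ξ ^ 12 / ((j : ℕ) : ℝ) ^ 4) with hf
  have hf0 : ∀ j, 0 ≤ f j := fun j => le_min (by positivity) (by positivity)
  refine (sum_range_le_split hf0 N n₀).trans ?_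
  have hhead : ∑ j ∈ Finset.range (n₀ + 1), f j ≤ (n₀ + 1) * (ξ ^ 4 / α ^ 4) := by
    have : ∀ j ∈ Finset.range (n₀ + 1), f j ≤ ξ ^ 4 / α ^ 4 := fun j _ => min_le_left _ _
    refine (Finset.sum_le_sum this).trans ?_
    rw [Finset.sum_const, Finset.card_range, nsmul_eq_mul]; push_cast; rfl
  have htail : ∑ j ∈ Finset.Ico (n₀ + 1) (N + 1), f j ≤ 64 * ξ ^ 12 * ((3 : ℕ) * (n₀ : ℝ) ^ 3)⁻¹ := by
    have h1 : ∀ j ∈ Finset.Ico (n₀ + 1) (N + 1), f j ≤ 64 * ξ ^ 12 * ((((j : ℕ) : ℝ)) ^ (3 + 1))⁻¹ := by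
      intro j hj
      calc f j ≤ 64 * ξ ^ 12 / ((j : ℕ) : ℝ) ^ 4 := min_le_right _ _
        _ = 64 * ξ ^ 12 * ((((j : ℕ) : ℝ)) ^ (3 + 1))⁻¹ := by rw [div_eq_mul_inv]
    refine (Finset.sum_le_sum h1).trans ?_
    rw [← Finset.mul_sum]
    exact mul_le_mul_of_nonneg_left (sum_Ico_inv_pow_succ_le (k := 3) (by norm_num) hn1 N)
      (by positivity)
  have e1 : (n₀ + 1) * (ξ ^ 4 / α ^ 4) ≤ 3 * ξ ^ 6 / α ^ 3 := by
    have h2 : (n₀ : ℝ) + 1 ≤ 3 * ξ ^ 2 * α := by nlinarith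
    rw [div_eq_mul_inv, div_eq_mul_inv]
    have hα4 : (α ^ 4)⁻¹ = α⁻¹ * (α ^ 3)⁻¹ := by rw [← mul_inv]; ring_nf
    rw [hα4]
    have : (n₀ + 1) * α⁻¹ ≤ 3 * ξ ^ 2 := by
      rw [← div_eq_mul_inv, div_le_iff₀ hα0]; linarith
    calc (n₀ + 1) * (ξ ^ 4 * (α⁻¹ * (α ^ 3)⁻¹)) = ((n₀ + 1) * α⁻¹) * (ξ ^ 4 * (α ^ 3)⁻¹) := by ring
      _ ≤ 3 * ξ ^ 2 * (ξ ^ 4 * (α ^ 3)⁻¹) := mul_le_mul_of_nonneg_right this (by positivity)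
      _ = 3 * ξ ^ 6 * (α ^ 3)⁻¹ := by ring
  have e2 : 64 * ξ ^ 12 * ((3 : ℕ) * (n₀ : ℝ) ^ 3)⁻¹ ≤ 22 * ξ ^ 6 / α ^ 3 := by
    have h3 : (ξ ^ 2 * α) ^ 3 ≤ (n₀ : ℝ) ^ 3 := pow_le_pow_left₀ (by positivity) hnlo 3
    have : ((3 : ℕ) * (n₀ : ℝ) ^ 3)⁻¹ ≤ (3 * (ξ ^ 2 * α) ^ 3)⁻¹ := by
      rw [inv_le_inv₀ (by positivity) (by positivity)]; push_cast; linarith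
    calc 64 * ξ ^ 12 * ((3 : ℕ) * (n₀ : ℝ) ^ 3)⁻¹ ≤ 64 * ξ ^ 12 * (3 * (ξ ^ 2 * α) ^ 3)⁻¹ :=
          mul_le_mul_of_nonneg_left this (by positivity)
      _ = 64 / 3 * ξ ^ 6 / α ^ 3 := by field_simp
      _ ≤ 22 * ξ ^ 6 / α ^ 3 := by
          rw [div_le_div_iff_of_pos_right (by positivity)]; nlinarith [pow_pos hξ0 6]
  have : 3 * ξ ^ 6 / α ^ 3 + 22 * ξ ^ 6 / α ^ 3 = 25 * ξ ^ 6 / α ^ 3 := by ring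
  linarith

/-- **`Σ_{j ≤ N} μ_j² ≤ 589 ξ¹⁰/α⁷`** (head `≤ (n₀+1) ξ⁸/α⁸ ≤ 3ξ¹⁰/α⁷`, tail
`4096ξ²⁴ Σ_{j>n₀} j⁻⁸ ≤ 4096ξ²⁴/(7n₀⁷) ≤ 586ξ¹⁰/α⁷`). [folklore] -/
theorem sum_mu_sq_le {ξ α : ℝ} (hξ : 1 ≤ ξ) (hα : 1 ≤ α) (N : ℕ) :
    ∑ j ∈ Finset.range (N + 1), (min (ξ ^ 4 / α ^ 4) (64 * ξ ^ 12 / ((j : ℕ) : ℝ) ^ 4)) ^ 2 ≤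
      589 * ξ ^ 10 / α ^ 7 := by
  obtain ⟨hn1, hnlo, hnhi⟩ := n0_facts hξ hα
  set n₀ : ℕ := ⌊2 * ξ ^ 2 * α⌋₊ with hn₀
  have hξ0 : 0 < ξ := by linarith
  have hα0 : 0 < α := by linarith
  have hn0R : (1 : ℝ) ≤ n₀ := by exact_mod_cast hn1
  set f : ℕ → ℝ := fun j => (min (ξ ^ 4 / α ^ 4) (64 * ξ ^ 12 / ((j : ℕ) : ℝ) ^ 4)) ^ 2 with hf
  have hmin0 : ∀ j : ℕ, 0 ≤ min (ξ ^ 4 / α ^ 4) (64 * ξ ^ 12 / ((j : ℕ) : ℝ) ^ 4) :=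
    fun j => le_min (by positivity) (by positivity)
  have hf0 : ∀ j, 0 ≤ f j := fun j => sq_nonneg _
  refine (sum_range_le_split hf0 N n₀).trans ?_
  have hhead : ∑ j ∈ Finset.range (n₀ + 1), f j ≤ (n₀ + 1) * (ξ ^ 4 / α ^ 4) ^ 2 := by
    have : ∀ j ∈ Finset.range (n₀ + 1), f j ≤ (ξ ^ 4 / α ^ 4) ^ 2 :=
      fun j _ => pow_le_pow_left₀ (hmin0 j) (min_le_left _ _) 2
    refine (Finset.sum_le_sum this).trans ?_
    rw [Finset.sum_const, Finset.card_range, nsmul_eq_mul]; push_cast; rfl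
  have htail : ∑ j ∈ Finset.Ico (n₀ + 1) (N + 1), f j ≤
      (64 * ξ ^ 12) ^ 2 * ((7 : ℕ) * (n₀ : ℝ) ^ 7)⁻¹ := by
    have h1 : ∀ j ∈ Finset.Ico (n₀ + 1) (N + 1), f j ≤ (64 * ξ ^ 12) ^ 2 * ((((j : ℕ) : ℝ)) ^ (7 + 1))⁻¹ := by
      intro j hj
      calc f j ≤ (64 * ξ ^ 12 / ((j : ℕ) : ℝ) ^ 4) ^ 2 :=
            pow_le_pow_left₀ (hmin0 j) (min_le_right _ _) 2
        _ = (64 * ξ ^ 12) ^ 2 * ((((j : ℕ) : ℝ)) ^ (7 + 1))⁻¹ := by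
            rw [div_pow, div_eq_mul_inv]; ring
    refine (Finset.sum_le_sum h1).trans ?_
    rw [← Finset.mul_sum]
    exact mul_le_mul_of_nonneg_left (sum_Ico_inv_pow_succ_le (k := 7) (by norm_num) hn1 N)
      (by positivity)
  have e1 : (n₀ + 1) * (ξ ^ 4 / α ^ 4) ^ 2 ≤ 3 * ξ ^ 10 / α ^ 7 := by
    have h2 : (n₀ : ℝ) + 1 ≤ 3 * ξ ^ 2 * α := by nlinarith
    have : (ξ ^ 4 / α ^ 4) ^ 2 = ξ ^ 8 * α / α ^ 9 := by field_simp
    rw [this, show 3 * ξ ^ 10 / α ^ 7 = (3 * ξ ^ 2 * α) * (ξ ^ 8 * α / α ^ 9) by field_simp]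
    exact mul_le_mul_of_nonneg_right h2 (by positivity)
  have e2 : (64 * ξ ^ 12) ^ 2 * ((7 : ℕ) * (n₀ : ℝ) ^ 7)⁻¹ ≤ 586 * ξ ^ 10 / α ^ 7 := by
    have h3 : (ξ ^ 2 * α) ^ 7 ≤ (n₀ : ℝ) ^ 7 := pow_le_pow_left₀ (by positivity) hnlo 7
    have : ((7 : ℕ) * (n₀ : ℝ) ^ 7)⁻¹ ≤ (7 * (ξ ^ 2 * α) ^ 7)⁻¹ := by
      rw [inv_le_inv₀ (by positivity) (by positivity)]; push_cast; linarith
    calc (64 * ξ ^ 12) ^ 2 * ((7 : ℕ) * (n₀ : ℝ) ^ 7)⁻¹ ≤ (64 * ξ ^ 12) ^ 2 * (7 * (ξ ^ 2 * α) ^ 7)⁻¹ :=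
          mul_le_mul_of_nonneg_left this (by positivity)
      _ = 4096 / 7 * ξ ^ 10 / α ^ 7 := by field_simp; ring
      _ ≤ 586 * ξ ^ 10 / α ^ 7 := by
          rw [div_le_div_iff_of_pos_right (by positivity)]; nlinarith [pow_pos hξ0 10]
  have : 3 * ξ ^ 10 / α ^ 7 + 586 * ξ ^ 10 / α ^ 7 = 589 * ξ ^ 10 / α ^ 7 := by ring
  linarith

/-! ### The `b`-sums for fixed `a` -/

/-- **The large-`b` sum**: for `a = α³ ≥ 1`, `1 ≤ α ≤ ξ`, `N ≤ (5/2)ξ³`: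
`Σ_{b ≤ N} (24b²M_b + 128a²M_b²) ≤ 132ξ⁹ + 28a²ξ³ + 1600aξ⁶ + 77312ξ¹⁰/α`
(`M_b = ¼ + μ_b`; `sum_sq_mul_mu_le`, `sum_mu_le`, `sum_mu_sq_le`). [folklore] -/
theorem sum_large_le {a ξ α : ℝ} (hξ : 1 ≤ ξ) (hα : 1 ≤ α) (hαa : α ^ 3 = a) {N : ℕ}
    (hN : (N : ℝ) ≤ 5 / 2 * ξ ^ 3) :
    ∑ j ∈ Finset.range (N + 1),
      (24 * ((j : ℕ) : ℝ) ^ 2 * (1 / 4 + min (ξ ^ 4 / α ^ 4) (64 * ξ ^ 12 / ((j : ℕ) : ℝ) ^ 4)) +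
        128 * a ^ 2 * (1 / 4 + min (ξ ^ 4 / α ^ 4) (64 * ξ ^ 12 / ((j : ℕ) : ℝ) ^ 4)) ^ 2) ≤
      132 * ξ ^ 9 + 28 * a ^ 2 * ξ ^ 3 + 1600 * a * ξ ^ 6 + 77312 * ξ ^ 10 / α := by
  have hξ0 : 0 < ξ := by linarith
  have hα0 : 0 < α := by linarith
  have ha0 : 0 < a := by rw [← hαa]; positivity
  set μ : ℕ → ℝ := fun j => min (ξ ^ 4 / α ^ 4) (64 * ξ ^ 12 / ((j : ℕ) : ℝ) ^ 4) with hμ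
  have hexp : ∀ j ∈ Finset.range (N + 1),
      24 * ((j : ℕ) : ℝ) ^ 2 * (1 / 4 + μ j) + 128 * a ^ 2 * (1 / 4 + μ j) ^ 2 =
        6 * ((j : ℕ) : ℝ) ^ 2 + 24 * (((j : ℕ) : ℝ) ^ 2 * μ j) + 8 * a ^ 2 + 64 * a ^ 2 * μ j +
          128 * a ^ 2 * (μ j) ^ 2 := by
    intro j _; ring
  rw [Finset.sum_congr rfl hexp]
  simp only [Finset.sum_add_distrib, ← Finset.mul_sum, Finset.sum_const, Finset.card_range,
    nsmul_eq_mul]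
  have h1 := sum_sq_mul_mu_le hξ hα N
  have h2 := sum_mu_le hξ hα N
  have h3 := sum_mu_sq_le hξ hα N
  -- `Σ j² ≤ (N+1) N²`
  have h4 : ∑ j ∈ Finset.range (N + 1), ((j : ℕ) : ℝ) ^ 2 ≤ (N + 1) * (N : ℝ) ^ 2 := by
    have : ∀ j ∈ Finset.range (N + 1), ((j : ℕ) : ℝ) ^ 2 ≤ (N : ℝ) ^ 2 := by
      intro j hj
      rw [Finset.mem_range] at hj
      have : ((j : ℕ) : ℝ) ≤ N := by exact_mod_cast Nat.lt_succ_iff.mp hj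
      exact pow_le_pow_left₀ (by positivity) this 2
    refine (Finset.sum_le_sum this).trans ?_
    rw [Finset.sum_const, Finset.card_range, nsmul_eq_mul]; push_cast; rfl
  -- numerics
  have hN1 : (N : ℝ) + 1 ≤ 7 / 2 * ξ ^ 3 := by nlinarith [pow_pos hξ0 3, one_le_pow₀ (n := 3) hξ]
  have e1 : 6 * ((N + 1) * (N : ℝ) ^ 2) ≤ 132 * ξ ^ 9 := by
    have : (N : ℝ) ^ 2 ≤ (5 / 2 * ξ ^ 3) ^ 2 := pow_le_pow_left₀ (by positivity) hN 2
    calc 6 * ((N + 1) * (N : ℝ) ^ 2) ≤ 6 * ((7 / 2 * ξ ^ 3) * (5 / 2 * ξ ^ 3) ^ 2) := by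
          gcongr
      _ = 525 / 4 * ξ ^ 9 := by ring
      _ ≤ 132 * ξ ^ 9 := by nlinarith [pow_pos hξ0 9]
  have e2 : ((N : ℝ) + 1) * (8 * a ^ 2) ≤ 28 * a ^ 2 * ξ ^ 3 := by nlinarith [pow_pos ha0 2]
  have e3 : 64 * a ^ 2 * (25 * ξ ^ 6 / α ^ 3) = 1600 * a * ξ ^ 6 := by
    rw [← hαa]; field_simp; ring
  have e4 : 128 * a ^ 2 * (589 * ξ ^ 10 / α ^ 7) = 75392 * ξ ^ 10 / α := by
    rw [← hαa]; field_simp; ring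
  have i1 : 24 * ∑ j ∈ Finset.range (N + 1), ((j : ℕ) : ℝ) ^ 2 * μ j ≤ 24 * (80 * ξ ^ 10 / α) :=
    mul_le_mul_of_nonneg_left h1 (by norm_num)
  have i2 : 64 * a ^ 2 * ∑ j ∈ Finset.range (N + 1), μ j ≤ 64 * a ^ 2 * (25 * ξ ^ 6 / α ^ 3) :=
    mul_le_mul_of_nonneg_left h2 (by positivity)
  have i3 : 128 * a ^ 2 * ∑ j ∈ Finset.range (N + 1), (μ j) ^ 2 ≤ 128 * a ^ 2 * (589 * ξ ^ 10 / α ^ 7) :=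
    mul_le_mul_of_nonneg_left h3 (by positivity)
  have i4 : 6 * ∑ j ∈ Finset.range (N + 1), ((j : ℕ) : ℝ) ^ 2 ≤ 6 * ((N + 1) * (N : ℝ) ^ 2) :=
    mul_le_mul_of_nonneg_left h4 (by norm_num)
  have : 24 * (80 * ξ ^ 10 / α) + 75392 * ξ ^ 10 / α = 77312 * ξ ^ 10 / α := by ring
  push_cast at e2 ⊢
  linarith [i1, i2, i3, i4, e1, e2, e3, e4]

/-- **The small-`b` sum**: for `a = α³ ≥ 1`, `1 ≤ α ≤ ξ`:
`Σ_{0 ≤ b < 2a} (88a²P + 16a²P²) ≤ 480ξ⁹`, `P = ¼ + ξ⁴/α⁴ ≤ 2ξ⁴/α⁴`. [folklore] -/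
theorem sum_small_le {a ξ α : ℝ} (hα : 1 ≤ α) (hαξ : α ≤ ξ) (hαa : α ^ 3 = a) :
    2 * a * (88 * a ^ 2 * (1 / 4 + ξ ^ 4 / α ^ 4) + 16 * a ^ 2 * (1 / 4 + ξ ^ 4 / α ^ 4) ^ 2) ≤
      480 * ξ ^ 9 := by
  have hα0 : 0 < α := by linarith
  have hξ0 : 0 < ξ := by linarith
  have hq : 1 ≤ ξ ^ 4 / α ^ 4 := by
    rw [le_div_iff₀ (by positivity), one_mul]; exact pow_le_pow_left₀ hα0.le hαξ 4
  have hP : 1 / 4 + ξ ^ 4 / α ^ 4 ≤ 2 * (ξ ^ 4 / α ^ 4) := by linarith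
  have hP2 : (1 / 4 + ξ ^ 4 / α ^ 4) ^ 2 ≤ 4 * (ξ ^ 4 / α ^ 4) ^ 2 := by nlinarith
  have ha0 : 0 < a := by rw [← hαa]; positivity
  calc 2 * a * (88 * a ^ 2 * (1 / 4 + ξ ^ 4 / α ^ 4) + 16 * a ^ 2 * (1 / 4 + ξ ^ 4 / α ^ 4) ^ 2)
      ≤ 2 * a * (88 * a ^ 2 * (2 * (ξ ^ 4 / α ^ 4)) + 16 * a ^ 2 * (4 * (ξ ^ 4 / α ^ 4) ^ 2)) := by
        gcongr
    _ = 352 * α ^ 5 * ξ ^ 4 + 128 * α * ξ ^ 8 := by rw [← hαa]; field_simp; ring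
    _ ≤ 352 * ξ ^ 5 * ξ ^ 4 + 128 * ξ * ξ ^ 8 := by gcongr
    _ = 480 * ξ ^ 9 := by ring

/-! ### The count for fixed `a` -/

/-- **`b < (5/2)ξ³`** and **`a < ξ³`** for a reduced form with `a ≥ 1`, `−Disc < X = ξ¹²`
(`b = −a((θ−u) + 3u) ≤ a|θ−u| + (3/2)a`, `(a|θ−u|)⁴ < X/3`, `a⁴ < 16X/27`). [folklore] -/
theorem b_lt_of_witness {a θ u v X ξ : ℝ} (ha : 1 ≤ a) (hu : |u| ≤ 1 / 2) (hp : 1 ≤ u ^ 2 + v ^ 2)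
    (hX : 4 * a ^ 4 * ((θ - u) ^ 2 + v ^ 2) ^ 2 * v ^ 2 < X) (hξ : 0 < ξ) (hξX : ξ ^ 12 = X) :
    -a * (θ + 2 * u) < 5 / 2 * ξ ^ 3 ∧ a < ξ ^ 3 := by
  have ha0 : 0 < a := by linarith
  have hX0 : 0 < X := lt_of_le_of_lt (by positivity) hX
  have haw := aw_pow_four_lt (v := v) ha hu hp hX
  have ha4 := a_pow_four_lt (v := v) (θ := θ) ha hu hp hX
  have haw' : a * |θ - u| < ξ ^ 3 := by
    have : (a * |θ - u|) ^ 4 < (ξ ^ 3) ^ 4 := by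
      rw [show (ξ ^ 3) ^ 4 = ξ ^ 12 by ring, hξX]; linarith
    exact lt_of_pow_lt_pow_left₀ 4 (by positivity) this
  have ha' : a < ξ ^ 3 := by
    have : a ^ 4 < (ξ ^ 3) ^ 4 := by
      rw [show (ξ ^ 3) ^ 4 = ξ ^ 12 by ring, hξX]; linarith
    exact lt_of_pow_lt_pow_left₀ 4 (by positivity) this
  refine ⟨?_, ha'⟩
  have : -a * (θ + 2 * u) ≤ a * |θ - u| + 3 / 2 * a := by
    rw [show -a * (θ + 2 * u) = -(a * (θ - u)) + -(3 * a * u) by ring]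
    have h1 : -(a * (θ - u)) ≤ a * |θ - u| := by
      have := neg_abs_le (a * (θ - u)); rw [abs_mul, abs_of_pos ha0] at this; linarith
    have h2 : -(3 * a * u) ≤ 3 / 2 * a := by
      have := abs_le.mp hu; nlinarith
    linarith
  linarith

/-- **The reduced forms with fixed `a ≥ 1`**: `#{(b, d, c) : b ≥ 0, (a, b, c, d) Mathews-reduced,
−Disc < X} ≤ 612ξ⁹ + 28a²ξ³ + 1600aξ⁶ + 77312ξ¹⁰/α` (`X = ξ¹²`, `a = α³`; `b < (5/2)ξ³`, small/large `b`
via `ncard_dcFibre_neg_le_of_small/large`). [cite: Davenport1951CubicFormsII, §3] -/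
theorem ncard_aFibre_neg_le (a : ℤ) (ha : 1 ≤ a) {X ξ α : ℝ} (hξ : 1 ≤ ξ) (hξX : ξ ^ 12 = X)
    (hα : 1 ≤ α) (hαa : α ^ 3 = a) (hαξ : α ≤ ξ) :
    (({t : ℤ × (ℤ × ℤ) | 0 ≤ t.1 ∧ t.2.1 ≠ 0 ∧ ∃ θ u v : ℝ, 0 < v ∧ |u| ≤ 1 / 2 ∧ 1 ≤ u ^ 2 + v ^ 2 ∧
        (t.1 : ℝ) = -a * (θ + 2 * u) ∧ (t.2.2 : ℝ) = a * (2 * θ * u + (u ^ 2 + v ^ 2)) ∧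
        (t.2.1 : ℝ) = -a * (θ * (u ^ 2 + v ^ 2)) ∧
        4 * (a : ℝ) ^ 4 * ((θ - u) ^ 2 + v ^ 2) ^ 2 * v ^ 2 < X}).ncard : ℝ) ≤
      612 * ξ ^ 9 + 28 * (a : ℝ) ^ 2 * ξ ^ 3 + 1600 * a * ξ ^ 6 + 77312 * ξ ^ 10 / α := by
  classical
  have hξ0 : 0 < ξ := by linarith
  have hα0 : 0 < α := by linarith
  have haR : (1 : ℝ) ≤ a := by exact_mod_cast ha
  have ha0 : (0 : ℝ) < a := by linarith
  have hX0 : 0 < X := by rw [← hξX]; positivity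
  set S := {t : ℤ × (ℤ × ℤ) | 0 ≤ t.1 ∧ t.2.1 ≠ 0 ∧ ∃ θ u v : ℝ, 0 < v ∧ |u| ≤ 1 / 2 ∧ 1 ≤ u ^ 2 + v ^ 2 ∧
        (t.1 : ℝ) = -a * (θ + 2 * u) ∧ (t.2.2 : ℝ) = a * (2 * θ * u + (u ^ 2 + v ^ 2)) ∧
        (t.2.1 : ℝ) = -a * (θ * (u ^ 2 + v ^ 2)) ∧
        4 * (a : ℝ) ^ 4 * ((θ - u) ^ 2 + v ^ 2) ^ 2 * v ^ 2 < X} with hS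
  -- the `(d, c)`-fibres are the sets of `DavenportBoundNegPairs`
  set F : ℤ → Set (ℤ × ℤ) := fun b => {q : ℤ × ℤ | q.1 ≠ 0 ∧ ∃ θ u v : ℝ, 0 < v ∧ |u| ≤ 1 / 2 ∧
      1 ≤ u ^ 2 + v ^ 2 ∧ (b : ℝ) = -a * (θ + 2 * u) ∧ (q.2 : ℝ) = a * (2 * θ * u + (u ^ 2 + v ^ 2)) ∧
      (q.1 : ℝ) = -a * (θ * (u ^ 2 + v ^ 2)) ∧ 4 * (a : ℝ) ^ 4 * ((θ - u) ^ 2 + v ^ 2) ^ 2 * v ^ 2 < X}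
    with hF
  have hfib : ∀ b : ℤ, {q : ℤ × ℤ | (b, q) ∈ S} ⊆ F b := by
    rintro b q ⟨-, hq⟩; exact hq
  -- the `b`-range
  set N : ℕ := ⌊5 / 2 * ξ ^ 3⌋₊ with hN
  have hNle : (N : ℝ) ≤ 5 / 2 * ξ ^ 3 := Nat.floor_le (by positivity)
  set B : Finset ℤ := (Finset.range (N + 1)).image (fun j : ℕ => (j : ℤ)) with hB
  have hmemB : ∀ t ∈ S, t.1 ∈ B := by
    rintro ⟨b, d, c⟩ ⟨hb0, -, θ, u, v, hv, hu, hp, hb', hc', hd', hX'⟩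
    simp only at hb0 hb'
    have hbR : (b : ℝ) < 5 / 2 * ξ ^ 3 := by
      rw [hb']; exact (b_lt_of_witness haR hu hp hX' hξ0 hξX).1
    have hbN : b.toNat ≤ N := by
      rw [hN]; apply Nat.le_floor
      have : ((b.toNat : ℕ) : ℝ) = ((b : ℤ) : ℝ) := by exact_mod_cast Int.toNat_of_nonneg hb0
      rw [this]; exact hbR.le
    rw [hB, Finset.mem_image]
    exact ⟨b.toNat, Finset.mem_range.mpr (by omega), Int.toNat_of_nonneg hb0⟩
  have hfinB : ∀ b ∈ B, {q : ℤ × ℤ | (b, q) ∈ S}.Finite := fun b _ =>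
    (dcFibre_neg_finite a b ha hξ0 hξX hα0 hαa).subset (hfib b)
  have step1 := ncard_le_sum_ncard_fibre S B hmemB hfinB
  -- rewrite the sum over `B` as a sum over `j ≤ N`
  have hinj : Set.InjOn (fun j : ℕ => (j : ℤ)) ↑(Finset.range (N + 1)) := by
    intro i _ j _ h
    have h' : (i : ℤ) = (j : ℤ) := h
    exact_mod_cast h'
  rw [hB, Finset.sum_image hinj] at step1
  -- per-`b` bounds
  set g : ℕ → ℝ := fun j => (({q : ℤ × ℤ | ((j : ℤ), q) ∈ S}).ncard : ℝ) with hg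
  have hg0 : ∀ j, 0 ≤ g j := fun j => by positivity
  set aN : ℕ := (2 * a).toNat with haN
  have haN1 : 1 ≤ aN - 1 + 1 := by omega
  have haNeq : ((aN - 1 + 1 : ℕ) : ℤ) = 2 * a := by omega
  have hsplit := sum_range_le_split hg0 N (aN - 1)
  -- small `b`
  have hsmall : ∑ j ∈ Finset.range (aN - 1 + 1), g j ≤ 480 * ξ ^ 9 := by
    have h1 : ∀ j ∈ Finset.range (aN - 1 + 1), g j ≤
        88 * (a : ℝ) ^ 2 * (1 / 4 + ξ ^ 4 / α ^ 4) + 16 * (a : ℝ) ^ 2 * (1 / 4 + ξ ^ 4 / α ^ 4) ^ 2 := by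
      intro j hj
      rw [Finset.mem_range] at hj
      have hjb : |(((j : ℤ)) : ℝ)| < 2 * a := by
        rw [show (((j : ℤ)) : ℝ) = ((j : ℕ) : ℝ) by push_cast; rfl, abs_of_nonneg (by positivity)]
        have : ((j : ℕ) : ℤ) < 2 * a := by omega
        exact_mod_cast this
      calc g j ≤ ((F (j : ℤ)).ncard : ℝ) := by
            have := Set.ncard_le_ncard (hfib (j : ℤ)) (dcFibre_neg_finite a _ ha hξ0 hξX hα0 hαa)
            rw [hg]
            show (({q : ℤ × ℤ | ((j : ℤ), q) ∈ S}).ncard : ℝ) ≤ ((F (j : ℤ)).ncard : ℝ)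
            exact_mod_cast this
        _ ≤ _ := ncard_dcFibre_neg_le_of_small a (j : ℤ) ha hjb hξ0 hξX hα0 hαa hαξ
    refine (Finset.sum_le_sum h1).trans ?_
    rw [Finset.sum_const, Finset.card_range, nsmul_eq_mul]
    have : ((aN - 1 + 1 : ℕ) : ℝ) = 2 * a := by exact_mod_cast haNeq
    rw [this]
    exact sum_small_le hα hαξ hαa
  -- large `b`
  have hlarge : ∑ j ∈ Finset.Ico (aN - 1 + 1) (N + 1), g j ≤
      132 * ξ ^ 9 + 28 * (a : ℝ) ^ 2 * ξ ^ 3 + 1600 * a * ξ ^ 6 + 77312 * ξ ^ 10 / α := by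
    set h : ℕ → ℝ := fun j => 24 * ((j : ℕ) : ℝ) ^ 2 * (1 / 4 + min (ξ ^ 4 / α ^ 4) (64 * ξ ^ 12 / ((j : ℕ) : ℝ) ^ 4)) +
        128 * (a : ℝ) ^ 2 * (1 / 4 + min (ξ ^ 4 / α ^ 4) (64 * ξ ^ 12 / ((j : ℕ) : ℝ) ^ 4)) ^ 2 with hh
    have hh0 : ∀ j, 0 ≤ h j := by
      intro j
      have : 0 ≤ min (ξ ^ 4 / α ^ 4) (64 * ξ ^ 12 / ((j : ℕ) : ℝ) ^ 4) := le_min (by positivity) (by positivity)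
      rw [hh]; positivity
    have h1 : ∀ j ∈ Finset.Ico (aN - 1 + 1) (N + 1), g j ≤ h j := by
      intro j hj
      rw [Finset.mem_Ico] at hj
      have hjb : 2 * (a : ℝ) ≤ |(((j : ℤ)) : ℝ)| := by
        rw [show (((j : ℤ)) : ℝ) = ((j : ℕ) : ℝ) by push_cast; rfl, abs_of_nonneg (by positivity)]
        have : 2 * a ≤ ((j : ℕ) : ℤ) := by omega
        exact_mod_cast this
      calc g j ≤ ((F (j : ℤ)).ncard : ℝ) := by
            have := Set.ncard_le_ncard (hfib (j : ℤ)) (dcFibre_neg_finite a _ ha hξ0 hξX hα0 hαa)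
            rw [hg]
            show (({q : ℤ × ℤ | ((j : ℤ), q) ∈ S}).ncard : ℝ) ≤ ((F (j : ℤ)).ncard : ℝ)
            exact_mod_cast this
        _ ≤ _ := ncard_dcFibre_neg_le_of_large a (j : ℤ) ha hjb hξ0 hξX hα0 hαa
        _ = h j := by
            rw [hh, ← hξX]
            simp only [Int.cast_natCast]
    calc ∑ j ∈ Finset.Ico (aN - 1 + 1) (N + 1), g j ≤ ∑ j ∈ Finset.Ico (aN - 1 + 1) (N + 1), h j :=
          Finset.sum_le_sum h1
      _ ≤ ∑ j ∈ Finset.range (N + 1), h j := by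
          apply Finset.sum_le_sum_of_subset_of_nonneg
          · intro j hj; rw [Finset.mem_Ico] at hj; rw [Finset.mem_range]; omega
          · intro j _ _; exact hh0 j
      _ ≤ _ := sum_large_le hξ hα hαa hNle
  linarith [step1, hsplit, hsmall, hlarge]

/-- The reduced forms with fixed `a ≥ 1` form a finite set. [folklore] -/
theorem aFibre_neg_finite (a : ℤ) (ha : 1 ≤ a) {X ξ α : ℝ} (hξ : 1 ≤ ξ) (hξX : ξ ^ 12 = X)
    (hα : 1 ≤ α) (hαa : α ^ 3 = a) :
    ({t : ℤ × (ℤ × ℤ) | 0 ≤ t.1 ∧ t.2.1 ≠ 0 ∧ ∃ θ u v : ℝ, 0 < v ∧ |u| ≤ 1 / 2 ∧ 1 ≤ u ^ 2 + v ^ 2 ∧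
        (t.1 : ℝ) = -a * (θ + 2 * u) ∧ (t.2.2 : ℝ) = a * (2 * θ * u + (u ^ 2 + v ^ 2)) ∧
        (t.2.1 : ℝ) = -a * (θ * (u ^ 2 + v ^ 2)) ∧
        4 * (a : ℝ) ^ 4 * ((θ - u) ^ 2 + v ^ 2) ^ 2 * v ^ 2 < X}).Finite := by
  have hξ0 : 0 < ξ := by linarith
  have hα0 : 0 < α := by linarith
  have haR : (1 : ℝ) ≤ a := by exact_mod_cast ha
  set N : ℕ := ⌊5 / 2 * ξ ^ 3⌋₊ with hN
  refine (((Finset.Icc (0 : ℤ) N).finite_toSet).biUnion fun b _ =>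
    ((dcFibre_neg_finite a b ha hξ0 hξX hα0 hαa).image (Prod.mk b))).subset ?_
  rintro ⟨b, d, c⟩ ⟨hb0, hd0, θ, u, v, hv, hu, hp, hb', hc', hd', hX'⟩
  simp only at hb0 hd0 hb' hc' hd'
  rw [Set.mem_iUnion₂]
  have hbR : (b : ℝ) < 5 / 2 * ξ ^ 3 := by
    rw [hb']; exact (b_lt_of_witness haR hu hp hX' hξ0 hξX).1
  have hbN : b ≤ (N : ℤ) := by
    have h1 : b.toNat ≤ N := by
      rw [hN]; apply Nat.le_floor
      have : ((b.toNat : ℕ) : ℝ) = ((b : ℤ) : ℝ) := by exact_mod_cast Int.toNat_of_nonneg hb0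
      rw [this]; exact hbR.le
    omega
  refine ⟨b, Finset.mem_coe.mpr (Finset.mem_Icc.mpr ⟨hb0, hbN⟩), ⟨(d, c), ?_, rfl⟩⟩
  exact ⟨hd0, θ, u, v, hv, hu, hp, hb', hc', hd', hX'⟩

/-! ### The total count -/

/-- **The number of Mathews-reduced integral binary cubic forms `(a, b, c, d)` with `a ≥ 1`, `b ≥ 0`,
`d ≠ 0` and `0 < −Disc < X` is `≤ 118208·X`** (`X = ξ¹²`; sum of `ncard_aFibre_neg_le` over
`1 ≤ a ≤ ξ³` with `Σ_{a ≤ A} a^{-1/3} ≤ (3/2)A^{2/3}`). [cite: Davenport1951CubicFormsII, Theorem] -/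
theorem ncard_negRed_le {X ξ : ℝ} (hξ : 1 ≤ ξ) (hξX : ξ ^ 12 = X) :
    (({z : ℤ × (ℤ × (ℤ × ℤ)) | 1 ≤ z.1 ∧ 0 ≤ z.2.1 ∧ z.2.2.1 ≠ 0 ∧ ∃ θ u v : ℝ, 0 < v ∧ |u| ≤ 1 / 2 ∧
        1 ≤ u ^ 2 + v ^ 2 ∧ (z.2.1 : ℝ) = -z.1 * (θ + 2 * u) ∧
        (z.2.2.2 : ℝ) = z.1 * (2 * θ * u + (u ^ 2 + v ^ 2)) ∧ (z.2.2.1 : ℝ) = -z.1 * (θ * (u ^ 2 + v ^ 2)) ∧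
        4 * (z.1 : ℝ) ^ 4 * ((θ - u) ^ 2 + v ^ 2) ^ 2 * v ^ 2 < X}).ncard : ℝ) ≤ 118208 * ξ ^ 12 := by
  classical
  have hξ0 : 0 < ξ := by linarith
  set S := {z : ℤ × (ℤ × (ℤ × ℤ)) | 1 ≤ z.1 ∧ 0 ≤ z.2.1 ∧ z.2.2.1 ≠ 0 ∧ ∃ θ u v : ℝ, 0 < v ∧ |u| ≤ 1 / 2 ∧
        1 ≤ u ^ 2 + v ^ 2 ∧ (z.2.1 : ℝ) = -z.1 * (θ + 2 * u) ∧
        (z.2.2.2 : ℝ) = z.1 * (2 * θ * u + (u ^ 2 + v ^ 2)) ∧ (z.2.2.1 : ℝ) = -z.1 * (θ * (u ^ 2 + v ^ 2)) ∧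
        4 * (z.1 : ℝ) ^ 4 * ((θ - u) ^ 2 + v ^ 2) ^ 2 * v ^ 2 < X} with hS
  set Na : ℕ := ⌊ξ ^ 3⌋₊ with hNadef
  have hNa : (Na : ℝ) ≤ ξ ^ 3 := Nat.floor_le (by positivity)
  set A : Finset ℤ := (Finset.range Na).image (fun i : ℕ => (i : ℤ) + 1) with hA
  -- cube roots
  set α : ℕ → ℝ := fun n => ((n : ℕ) : ℝ) ^ ((3 : ℕ) : ℝ)⁻¹ with hαdef
  have hα3 : ∀ n : ℕ, (α n) ^ 3 = n := fun n => Real.rpow_inv_natCast_pow (by positivity) (by norm_num)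
  have hα1 : ∀ n : ℕ, 1 ≤ n → 1 ≤ α n := by
    intro n hn
    rw [hαdef]; exact Real.one_le_rpow (by exact_mod_cast hn) (by positivity)
  have hαξ : ∀ n : ℕ, n ≤ Na → α n ≤ ξ := by
    intro n hn
    have h1 : ((n : ℕ) : ℝ) ≤ ξ ^ 3 := (show ((n : ℕ) : ℝ) ≤ Na by exact_mod_cast hn).trans hNa
    calc α n ≤ (ξ ^ 3) ^ ((3 : ℕ) : ℝ)⁻¹ := Real.rpow_le_rpow (by positivity) h1 (by positivity)
      _ = ξ := Real.pow_rpow_inv_natCast hξ0.le (by norm_num)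
  -- fibres over `a`
  have hmemA : ∀ z ∈ S, z.1 ∈ A := by
    rintro ⟨a, b, d, c⟩ ⟨ha, hb0, hd0, θ, u, v, hv, hu, hp, hb', hc', hd', hX'⟩
    simp only at ha hb' hX'
    have haR : (1 : ℝ) ≤ a := by exact_mod_cast ha
    have ha' : (a : ℝ) < ξ ^ 3 := (b_lt_of_witness haR hu hp hX' hξ0 hξX).2
    have haNa : a.toNat ≤ Na := by
      rw [hNadef]; apply Nat.le_floor
      have : ((a.toNat : ℕ) : ℝ) = ((a : ℤ) : ℝ) := by exact_mod_cast Int.toNat_of_nonneg (by omega)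
      rw [this]; exact ha'.le
    rw [hA, Finset.mem_image]
    exact ⟨(a - 1).toNat, Finset.mem_range.mpr (by omega), by omega⟩
  have hfib : ∀ a : ℤ, 1 ≤ a → {t : ℤ × (ℤ × ℤ) | (a, t) ∈ S} =
      {t : ℤ × (ℤ × ℤ) | 0 ≤ t.1 ∧ t.2.1 ≠ 0 ∧ ∃ θ u v : ℝ, 0 < v ∧ |u| ≤ 1 / 2 ∧ 1 ≤ u ^ 2 + v ^ 2 ∧
        (t.1 : ℝ) = -a * (θ + 2 * u) ∧ (t.2.2 : ℝ) = a * (2 * θ * u + (u ^ 2 + v ^ 2)) ∧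
        (t.2.1 : ℝ) = -a * (θ * (u ^ 2 + v ^ 2)) ∧
        4 * (a : ℝ) ^ 4 * ((θ - u) ^ 2 + v ^ 2) ^ 2 * v ^ 2 < X} := by
    intro a ha
    ext t
    simp only [hS, Set.mem_setOf_eq]
    exact ⟨fun h => h.2, fun h => ⟨ha, h⟩⟩
  have hmemA' : ∀ a ∈ A, 1 ≤ a ∧ (a - 1).toNat < Na ∧ (((a - 1).toNat : ℕ) : ℤ) + 1 = a := by
    intro a ha
    rw [hA, Finset.mem_image] at ha
    obtain ⟨i, hi, rfl⟩ := ha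
    rw [Finset.mem_range] at hi
    refine ⟨by omega, by simpa using hi, by simp⟩
  have hfinA : ∀ a ∈ A, {t : ℤ × (ℤ × ℤ) | (a, t) ∈ S}.Finite := by
    intro a ha
    obtain ⟨ha1, -, -⟩ := hmemA' a ha
    rw [hfib a ha1]
    have hαa : (α a.toNat) ^ 3 = a := by
      rw [hα3]; exact_mod_cast Int.toNat_of_nonneg (by omega)
    exact aFibre_neg_finite a ha1 hξ hξX (hα1 _ (by omega)) hαa
  have step1 := ncard_le_sum_ncard_fibre S A hmemA hfinA
  -- per-`a` bound as a function of `i`, `a = i + 1`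
  set Φ : ℕ → ℝ := fun i => 612 * ξ ^ 9 + 28 * (((i + 1 : ℕ)) : ℝ) ^ 2 * ξ ^ 3 +
      1600 * (((i + 1 : ℕ)) : ℝ) * ξ ^ 6 + 77312 * ξ ^ 10 / α (i + 1) with hΦ
  have step2 : ∀ a ∈ A, (({t : ℤ × (ℤ × ℤ) | (a, t) ∈ S}).ncard : ℝ) ≤ Φ (a - 1).toNat := by
    intro a ha
    obtain ⟨ha1, hi, hia⟩ := hmemA' a ha
    rw [hfib a ha1]
    have hnat : (a - 1).toNat + 1 = a.toNat := by omega
    have hαa : (α ((a - 1).toNat + 1)) ^ 3 = a := by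
      rw [hα3, hnat]; exact_mod_cast Int.toNat_of_nonneg (by omega)
    have h := ncard_aFibre_neg_le a ha1 hξ hξX (hα1 _ (by omega)) hαa (hαξ _ (by omega))
    have e : ((((a - 1).toNat + 1 : ℕ)) : ℝ) = (a : ℝ) := by
      rw [hnat]; exact_mod_cast Int.toNat_of_nonneg (by omega)
    rw [hΦ]; simp only; rw [e]; exact h
  have hinj : Set.InjOn (fun i : ℕ => (i : ℤ) + 1) ↑(Finset.range Na) := by
    intro i _ j _ h
    have h' : (i : ℤ) + 1 = (j : ℤ) + 1 := h
    exact_mod_cast add_right_cancel h'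
  have step3 : ∑ a ∈ A, (({t : ℤ × (ℤ × ℤ) | (a, t) ∈ S}).ncard : ℝ) ≤ ∑ i ∈ Finset.range Na, Φ i := by
    refine (Finset.sum_le_sum step2).trans ?_
    rw [hA, Finset.sum_image hinj]
    refine (Finset.sum_congr rfl fun i _ => ?_).le
    congr 1; omega
  -- summing `Φ`
  have hsumsq : ∑ i ∈ Finset.range Na, (((i + 1 : ℕ)) : ℝ) ^ 2 ≤ (Na : ℝ) ^ 3 := by
    have : ∀ i ∈ Finset.range Na, (((i + 1 : ℕ)) : ℝ) ^ 2 ≤ (Na : ℝ) ^ 2 := by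
      intro i hi
      rw [Finset.mem_range] at hi
      have : (((i + 1 : ℕ)) : ℝ) ≤ Na := by exact_mod_cast hi
      exact pow_le_pow_left₀ (by positivity) this 2
    refine (Finset.sum_le_sum this).trans ?_
    rw [Finset.sum_const, Finset.card_range, nsmul_eq_mul]; ring_nf; rfl
  have hsumlin : ∑ i ∈ Finset.range Na, (((i + 1 : ℕ)) : ℝ) ≤ (Na : ℝ) ^ 2 := by
    have : ∀ i ∈ Finset.range Na, (((i + 1 : ℕ)) : ℝ) ≤ (Na : ℝ) := by
      intro i hi
      rw [Finset.mem_range] at hi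
      exact_mod_cast hi
    refine (Finset.sum_le_sum this).trans ?_
    rw [Finset.sum_const, Finset.card_range, nsmul_eq_mul]; ring_nf; rfl
  have hsuminv : ∑ i ∈ Finset.range Na, (α (i + 1))⁻¹ ≤ 3 / 2 * ξ ^ 2 := by
    refine (sum_inv_cubeRoot_le Na).trans ?_
    have : (((Na : ℕ) : ℝ) ^ ((3 : ℕ) : ℝ)⁻¹) ≤ ξ := hαξ Na le_rfl
    have h0 : 0 ≤ (((Na : ℕ) : ℝ) ^ ((3 : ℕ) : ℝ)⁻¹) := Real.rpow_nonneg (by positivity) _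
    nlinarith
  have hNa3 : (Na : ℝ) ^ 3 ≤ ξ ^ 9 := by
    calc (Na : ℝ) ^ 3 ≤ (ξ ^ 3) ^ 3 := pow_le_pow_left₀ (by positivity) hNa 3
      _ = ξ ^ 9 := by ring
  have hNa2 : (Na : ℝ) ^ 2 ≤ ξ ^ 6 := by
    calc (Na : ℝ) ^ 2 ≤ (ξ ^ 3) ^ 2 := pow_le_pow_left₀ (by positivity) hNa 2
      _ = ξ ^ 6 := by ring
  have step4 : ∑ i ∈ Finset.range Na, Φ i ≤ 118208 * ξ ^ 12 := by
    have hexp : ∀ i ∈ Finset.range Na, Φ i = 612 * ξ ^ 9 + 28 * ξ ^ 3 * (((i + 1 : ℕ)) : ℝ) ^ 2 +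
        1600 * ξ ^ 6 * (((i + 1 : ℕ)) : ℝ) + 77312 * ξ ^ 10 * (α (i + 1))⁻¹ := by
      intro i _; rw [hΦ]; simp only; ring
    rw [Finset.sum_congr rfl hexp]
    simp only [Finset.sum_add_distrib, ← Finset.mul_sum, Finset.sum_const, Finset.card_range,
      nsmul_eq_mul]
    have i1 : (Na : ℝ) * (612 * ξ ^ 9) ≤ ξ ^ 3 * (612 * ξ ^ 9) :=
      mul_le_mul_of_nonneg_right hNa (by positivity)
    have i2 : 28 * ξ ^ 3 * ∑ i ∈ Finset.range Na, (((i + 1 : ℕ)) : ℝ) ^ 2 ≤ 28 * ξ ^ 3 * ξ ^ 9 :=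
      mul_le_mul_of_nonneg_left (hsumsq.trans hNa3) (by positivity)
    have i3 : 1600 * ξ ^ 6 * ∑ i ∈ Finset.range Na, (((i + 1 : ℕ)) : ℝ) ≤ 1600 * ξ ^ 6 * ξ ^ 6 :=
      mul_le_mul_of_nonneg_left (hsumlin.trans hNa2) (by positivity)
    have i4 : 77312 * ξ ^ 10 * ∑ i ∈ Finset.range Na, (α (i + 1))⁻¹ ≤ 77312 * ξ ^ 10 * (3 / 2 * ξ ^ 2) :=
      mul_le_mul_of_nonneg_left hsuminv (by positivity)
    nlinarith [i1, i2, i3, i4]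
  linarith [step1, step3, step4]

end BinaryCubic

end Literature.NumberTheory.CubicFields

end
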